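import Summits.ResolutionOfSingularities.ResolutionOfSingularities.Theorems.ChainW52TargetsF7BetaRP
import HarnessLib

/-!
# Crux `PatchingRelPerfect` (stmt-ResolutionOfSingularities-16161), chain W5.2 — F7(β) d = 2 (β-AX): THE POLE ATLAS PREDICATE OF RECORD
# `CylReachP` = REACHABILITY BY PERMISSIBLE CYLINDER STEPS (targets v7 `ChainW52TargetsF7BetaRP`, RULING G12-1: `StepStable`
# with the CJS per-step fields `hsub`/`hBsing`/`hperm`) — the universal step-stable, initially valid predicate

[OURS · L1 W5.2 · res-L1-w52-lead-1 g6, X3 typer (res-L1-w52-plan-1 NOTE G11-23 (1) «`…DepthPhaseCAtlas.lean`: `def P_atlas`,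
`atlasInitial`, `stepStable_atlas`»; RULING G11-24 (3) «impredicatively this IS the reachability relation; if you prefer to export an
inductive `CylReach` … equally fine»; G11-39 NO OBJECTION; over targets v6 `ChainW52TargetsF7BetaR` per RULING G11-41/G11-46 —
`StepStable` with the cylinder LOWER bound, `AtlasInitial` with the generation-1 antecedents and `InitialShape`; v7 twin of
`…DepthPhaseCAtlas` p556442 (v6 `CylReach`, which closes under non-permissible centres — idea-1 K11, lead-1 (Q-b)/FINDING-2): here the
step also carries the CJS fields, so every pole clause may use PERMISSIBILITY / EQUIMULTIPLICITY of the centre (stub-1 (EQ)))] Replaces the role of NO printed item; NOT a statement of the manuscript under review; fact-free.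
OURS definitions (statement-lane rules: no instances, no notation).

THE CHOICE OF `P`. The composition `ChainW52F7BetaR.BetaTwoComposition₂` (targets v6, RULING G11-46) consumes ONE predicate `P` on cylinder states with
`StepStable P`, `AtlasInitial P` and `PhaseCTermination₂ P`.  This file fixes `P` once and for all as the LEAST predicate that is
initially valid and step-stable — REACHABILITY:
  `CylReach S cyl :⟺ ∀ P, StepStable P → AtlasInitial P → P S cyl`
(the impredicative definition of the inductive closure of «`cyl.V = ⊤`» under the lifted cylinder step of `StepStable`; no `inductive`
is needed, so no eliminator issues over the large index `X : Scheme`).  Then: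
* `atlasInitial_cylReach : AtlasInitial CylReach` and `stepStable_cylReach : StepStable CylReach` — by definition (two of the three
  `P`-obligations of `BetaTwoComposition₂` are DISCHARGED here, for good; res-D-pv-054's `transport_of_cjsB` is instantiated once with
  `P := CylReach`).
* `CylReach.induct` — THE INDUCTION PRINCIPLE: every step-stable, initially valid predicate holds on reachable cylinder states.  Every
  geometric POLE CLAUSE of res-L1-w52-idea-1's P3 (memo-2 §16.1: bare carrier host through every residual-cosupport point off `V`, snc
  with the members; (R2♭) member-wise minimal exponents on the carrier summand; INV-I; (P-reg)/(P-cone) tags; frozen germs / the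
  G11-26 atlas reading) becomes a SEPARATE lemma `CylReach S cyl → Clause S cyl`, proved clause by clause by showing `Clause ∧ …` step-stable
  and initially valid — later, as T3 needs them, WITHOUT re-running or re-typing the transport.
* `phaseCTermination₂_cylReach_of` — UNIVERSALITY: `PhaseCTermination₂ P` for ANY step-stable initially valid `P` gives
  `PhaseCTermination₂ CylReach`; so T3 for `CylReach` is the WEAKEST form of the T3 obligation, and any atlas idea-1 prefers to word
  can be used to prove it.
* `exists_atlas_of_phaseCTermination₂_cylReach` — the `∃ P, StepStable P ∧ AtlasInitial P ∧ PhaseCTermination₂ P` input of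
  `BetaTwoComposition₂` from the single remaining target `PhaseCTermination₂ CylReach`.

AI-written; AI review is weaker than expert review.

## References
* E. Bierstone, D. Grigoriev, P. Milman, J. Włodarczyk, arXiv:1206.3090, Def. 3.1.3, §4 Remark (3). [BierstoneGrigorievMilmanWlodarczyk2011]
* J. Kollár, *Lectures on Resolution of Singularities* (2007), (3.111) Steps 1–3. [Kollar2007]
-/

-- `Summit.<Summit>.<Sub>.Theorems` with `Sub = Summit` (single-conjunct summit, D-0017)
set_option linter.dupNamespace false

noncomputable section

open CategoryTheory AlgebraicGeometry TopologicalSpace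
open Literature.AlgebraicGeometry.Resolution

namespace Summit.ResolutionOfSingularities.ResolutionOfSingularities.Theorems.ChainW52F7BetaRP

universe u

open DepthMultiHost

/-- [OURS · L1 W5.2] **REACHABILITY BY CYLINDER STEPS — the pole atlas predicate of record.** `CylReach S cyl` holds iff `(S, cyl)`
satisfies every predicate on cylinder states that is initially valid (`AtlasInitial`: true whenever `cyl.V = ⊤`) and step-stable
(`StepStable`: survives one lifted cylinder step with all its data) — i.e. iff `(S, cyl)` lies in the inductive closure of the
generation-zero states under the lifted cylinder step.  [cite: Kollar2007, (3.111) Steps 1–3] -/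
def CylReach : ∀ ⦃X : Scheme.{u}⦄ (S : MultiHostState X), CylState S → Prop :=
  fun _ S cyl => ∀ P : ∀ ⦃X : Scheme.{u}⦄ (S : MultiHostState X), CylState S → Prop, StepStable P → AtlasInitial P → P S cyl

/-- [OURS · L1 W5.2] **Generation zero is reachable**: `AtlasInitial CylReach` (the `h₀` of T5). [folklore] -/
theorem atlasInitial_cylReach : AtlasInitial CylReach.{u} :=
  fun _ _ St cyl _ _ hV hZreg hZexc hZdim h𝓔 hXexc hn hshape _ _ hP₀ => hP₀ St cyl hV hZreg hZexc hZdim h𝓔 hXexc hn hshape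

/-- [OURS · L1 W5.2] **Reachability is step-stable**: `StepStable CylReach` (the `hP` of res-D-pv-054's `transport_of_cjsB`).
[cite: Kollar2007, (3.111) Step 1] -/
theorem stepStable_cylReach : StepStable CylReach.{u} := by
  intro X X' _ _ S cyl _ _ C hC0 hCreg hCrad 𝓑 h𝓑 h𝓑C D hD hsub hBsing hperm τ hτ η hη m hm hm' hsncX cyl' τZ hτZ hsq hker htr hbd hbdF hV' hlow h P hP hP₀
  exact hP S cyl C hC0 hCreg hCrad 𝓑 h𝓑 h𝓑C D hD hsub hBsing hperm τ hτ η hη m hm hm' hsncX cyl' τZ hτZ hsq hker htr hbd hbdF hV' hlow (h P hP hP₀)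

/-- [OURS · L1 W5.2] **THE INDUCTION PRINCIPLE**: a step-stable, initially valid predicate holds on every reachable cylinder state. Every
geometric pole clause of the atlas (idea-1 P3) is obtained this way, clause by clause. [folklore] -/
theorem CylReach.induct {P : ∀ ⦃X : Scheme.{u}⦄ (S : MultiHostState X), CylState S → Prop} (hP : StepStable P)
    (hP₀ : AtlasInitial P) {X : Scheme.{u}} {S : MultiHostState X} {cyl : CylState S} (h : CylReach S cyl) : P S cyl :=
  h P hP hP₀

/-- [OURS · L1 W5.2] **Minimality**: `CylReach` implies, pointwise, every step-stable initially valid predicate — restated as an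
inclusion of predicates. [folklore] -/
theorem cylReach_le {P : ∀ ⦃X : Scheme.{u}⦄ (S : MultiHostState X), CylState S → Prop} (hP : StepStable P) (hP₀ : AtlasInitial P) :
    ∀ ⦃X : Scheme.{u}⦄ (S : MultiHostState X) (cyl : CylState S), CylReach S cyl → P S cyl :=
  fun _ _ _ h => h.induct hP hP₀

/-- [OURS · L1 W5.2] **Relative induction**: to derive a clause `Q` on reachable states it suffices that `Q` be initially valid and
step-stable RELATIVE TO an already established initially valid `P` (the joint step may use `P S cyl`). [folklore] -/
theorem CylReach.induct_rel {P Q : ∀ ⦃X : Scheme.{u}⦄ (S : MultiHostState X), CylState S → Prop}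
    (hP₀ : AtlasInitial P) (hQ₀ : AtlasInitial Q) (hQ : StepStable (fun _ S cyl => P S cyl ∧ Q S cyl))
    {X : Scheme.{u}} {S : MultiHostState X} {cyl : CylState S} (h : CylReach S cyl) : Q S cyl :=
  (h.induct hQ fun _ _ St cyl _ _ hV hZreg hZexc hZdim h𝓔 hXexc hn hshape =>
    ⟨hP₀ St cyl hV hZreg hZexc hZdim h𝓔 hXexc hn hshape, hQ₀ St cyl hV hZreg hZexc hZdim h𝓔 hXexc hn hshape⟩).2

/-- [OURS · L1 W5.2] **UNIVERSALITY of the reachability atlas for T3**: Phase C termination for ANY step-stable, initially valid pole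
predicate gives Phase C termination for `CylReach` — T3 for `CylReach` is the weakest form of the obligation. [folklore] -/
theorem phaseCTermination₂_cylReach_of {P : ∀ ⦃X : Scheme.{u}⦄ (S : MultiHostState X), CylState S → Prop} (hP : StepStable P)
    (hP₀ : AtlasInitial P) (hT : PhaseCTermination₂ P) : PhaseCTermination₂ CylReach.{u} := by
  intro X _ hX hXe S cyl _ _ hZ hn 𝓒 𝓗 hfmt hreach
  exact hT hX hXe S cyl hZ hn 𝓒 𝓗 hfmt (hreach.induct hP hP₀)

/-- [OURS · L1 W5.2] **UNIVERSALITY for the C-I target** (RULING G11-36 split): `PhaseCOne P` for any step-stable initially valid `P` gives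
`PhaseCOne CylReach` — THE C-I target of record (G11-39 (ii)). [folklore] -/
theorem phaseCOne_cylReach_of {P : ∀ ⦃X : Scheme.{u}⦄ (S : MultiHostState X), CylState S → Prop} (hP : StepStable P)
    (hP₀ : AtlasInitial P) (hT : PhaseCOne P) : PhaseCOne CylReach.{u} := by
  intro X _ hX hXe S cyl _ _ hZ hn 𝓒 𝓗 hfmt hreach
  exact hT hX hXe S cyl hZ hn 𝓒 𝓗 hfmt (hreach.induct hP hP₀)

/-- [OURS · L1 W5.2] **The atlas input of T5-over-`PhaseCOne` (RULING G12-4, res-D-pv-021 `betaTwo_atomConclusion_of_phaseCOne`) from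
the single remaining target `PhaseCOne CylReach`.** [folklore] -/
theorem exists_atlasOne_of_phaseCOne_cylReach (hT : PhaseCOne CylReach.{u}) :
    ∃ P : ∀ ⦃X : Scheme.{u}⦄ (S : MultiHostState X), CylState S → Prop, StepStable P ∧ AtlasInitial P ∧ PhaseCOne P :=
  ⟨CylReach, stepStable_cylReach, atlasInitial_cylReach, hT⟩

/-- [OURS · L1 W5.2] **The atlas input of `BetaTwoComposition₂` from the single remaining target `PhaseCTermination₂ CylReach`.**
[folklore] -/
theorem exists_atlas_of_phaseCTermination₂_cylReach (hT : PhaseCTermination₂ CylReach.{u}) :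
    ∃ P : ∀ ⦃X : Scheme.{u}⦄ (S : MultiHostState X), CylState S → Prop,
      StepStable P ∧ AtlasInitial P ∧ PhaseCTermination₂ P :=
  ⟨CylReach, stepStable_cylReach, atlasInitial_cylReach, hT⟩

/-- [OURS · L1 W5.2] **The (β) d = 2 atom conclusion from the targets, atlas fixed**: with `P := CylReach` the composition statement
`BetaTwoComposition₂` reduces the CORE atom conclusion for (β) d = 2 graded members to T0, T2, T2c and `PhaseCTermination₂ CylReach`.
[folklore] -/
theorem betaTwoAtomConclusion₂_of_cylReach (hcomp : BetaTwoComposition₂.{u}) (h0 : InitialMultiHost₂.{u}) (h2 : CJSTransport₂.{u})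
    (h2c : FormatEndOnCyl₂.{u}) (hT : PhaseCTermination₂ CylReach.{u}) : BetaTwoAtomConclusion₂.{u} :=
  hcomp h0 h2 h2c (exists_atlas_of_phaseCTermination₂_cylReach hT)

end Summit.ResolutionOfSingularities.ResolutionOfSingularities.Theorems.ChainW52F7BetaRP

end
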